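import Summits.QuantumFields.YangMills.Theorems.FluctuationComparisonRegPrIntLSupTailFibreOdds
import HarnessLib

/-!
# `FluctuationComparisonRegPrIntLSectionTubeFibrewise` — LINE g22-4 «persistence_geometry», row TUBE∘ `SectionTubeMassIntCan`: THE TUBE ROW FROM A FIBREWISE TUBE
# CHARGE OF THE BOLTZMANN-WEIGHTED CONDITIONAL HAAR LAW, FOR AN ARBITRARY (NOT NECESSARILY MEASURABLE) CENTRE MAP
# (crux `UnitScaleTilt.FluctuationComparisonRegPrIntL`, stmt-QuantumFields-20520; row TUBE∘ of `Cruxes/FluctuationComparisonRegPrIntL/Lines/persistence_geometry.lean`,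
# ideator ym-r3-idea-1 g22; companion of ✓`…InteriorSectionPointwise` (GEOM∘ pointwise ∕ by choice) and of ✓C `…SupTailFibreOdds` (the disintegration door))

Cell `ym3-torus` (YM ladder rung R3 = continuum SU(2) Yang–Mills on T³ — a RUNG, NOT the Clay problem: not d = 4, not infinite volume, not a mass gap);
width seat `ym-ust-20520-w3` (gen 18, LEAD-20520); helper `--supports stmt-QuantumFields-20520`.  THEOREMS ONLY (0 `def`, 0 `sorry`, default heartbeats).

WHY.  TUBE∘ asks, for a section `σ` of the one-step averaging over the interior window, a floor `q > 0` with `q·Gibbs_K(D_{J,K}⁻¹B) ≤ Gibbs_K(D_{J,K}⁻¹B ∩ T_σ)` for every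
run `K ≥ J+1` and every measurable interior `B`, where `T_σ = {V | every bond of D_{J+1,K}V is r-close to σ(D_{J,K}V)}` is the `r`-link-tube around the section's
point ON THE FIBRE of the datum.  Its content (Bałaban's small-field positivity) is FIBREWISE: «given the datum `U`, the conditional law charges the tube around `σ U`».
This file is the door from the fibrewise sentence to the row, and it settles the measurability question raised by GEOM∘'s selector once and for all: the centre map
`σ` may be ANY function — the tube event `T_σ` is then possibly non-measurable, `gibbsK … T_σ` is its OUTER measure, and the door goes through the measurable hull
`toMeasurable` and the fibre support of the conditional kernel (lit ✓`T4AveragingDisintegration.condLaw_fibre_ae`).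
* §1 (generic: finite `ν` on a standard Borel fine space, measurable `D`, measurable weight `w`, ANY family of fibre events `E U` and ANY target `T` with
  `E U ∩ D⁻¹{U} ⊆ T` over the window) ★★`mul_le_withDensity_preimage_inter_of_fibrewise` — if for `(ν.map D)`-a.e. window datum `U` the `w`-weighted conditional law
  gives `E U` at least the fraction `q` of its mass, then `q·(ν·w)(D⁻¹B) ≤ (ν·w)(D⁻¹B ∩ T)` for every measurable `B` in the window (`T` arbitrary).
* §2 (the runs) ★★★`gibbsK_sectionTube_of_fibrewise` — TUBE∘'s inequality at `(J, K)` for ANY centre map `σ`, from the fibrewise tube charge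
  `ofReal q·∫⁻ e^{−β_K A} dκ_U ≤ ∫⁻_{tube_r(σ U)} e^{−β_K A} dκ_U` for `(dU_K.map D_{J,K})`-a.e. interior `U` (`κ_U = condLaw dU_K D_{J,K} U`).
* §3 ★★★`sectionTubeMassIntCan_of_fibrewise : ⟨FIB-TUBE∘⟩ → TUBE∘ VERBATIM` and ★★★`sectionTubeMass_noMeas_of_fibrewise` — the same with the token `Measurable σ →`
  deleted from TUBE∘ (the measurability-free re-typing recommended with ✓`…InteriorSectionPointwise` §5).
HONEST SCOPE.  Disintegration bookkeeping; ⟨FIB-TUBE∘⟩ — the `K`-uniform fibrewise tube charge, [Balaban1985UV3] (7), (38)–(40) — is the HYPOTHESIS and is NOT proved;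
TUBE∘, PERS₁∘, GEOM∘ (as typed), PLAQTAIL∘, LFR♯ᶜ∘, S2β, 20520, `YM3TorusSU2` NOT proved; the Yang–Mills mass gap is NOT proved.
HYP-SAT (cell RULING №42).  ⟨FIB-TUBE∘⟩'s letters sit at TUBE∘'s quantifier order (`q` after `F, γ, J, r, σ`, uniform in `K` only); no hand supplies it tonight.
References: [Balaban1985Averaging] (10) p. 19, Prop. 1 p. 22; [Balaban1985UV3] (7) p. 257, (38)–(40) p. 266; [Balaban1987RG1] (0.18)–(0.22) p. 255.
-/

noncomputable section

set_option autoImplicit false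

open MeasureTheory ProbabilityTheory Filter Topology Set
open scoped ENNReal NNReal
open Literature.MathematicalPhysics.QuantumFieldTheory.Balaban1983to89
open Literature.MathematicalPhysics.QuantumFieldTheory.Balaban1983to89.T3ContinuumYM3Torus
open Literature.MathematicalPhysics.QuantumFieldTheory.Balaban1983to89.T3NestedUnitLaws
open Literature.MathematicalPhysics.QuantumFieldTheory.Balaban1983to89.T3UnitLawDensityEML
open Literature.MathematicalPhysics.QuantumFieldTheory.Balaban1983to89.T3UnitScaleTilt
open Literature.MathematicalPhysics.QuantumFieldTheory.Balaban1983to89.T3TiltDescent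
open Literature.MathematicalPhysics.QuantumFieldTheory.Balaban1983to89.Missing
open Literature.MathematicalPhysics.QuantumFieldTheory.Balaban1983to89.T4AveragingDisintegration
open Summit.QuantumFields.YangMills.Theorems.FluctuationComparisonRegPrIntLSupTailFibreOdds

namespace Summit.QuantumFields.YangMills.Theorems.FluctuationComparisonRegPrIntLSectionTubeFibrewise

/-! ## §1 A fibrewise lower fraction is a setwise one — for an arbitrary target set -/

section Generic

variable {α β : Type*} [MeasurableSpace α] [MeasurableSpace β] [StandardBorelSpace β] [Nonempty β] [MeasurableEq α]

/-- ★★ **FIBREWISE CHARGE ⇒ SETWISE CHARGE OF AN ARBITRARY TARGET**: `ν` finite on a standard Borel fine space, `D` measurable, `w` a measurable weight, `E U` ANY family of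
fine events and `T` ANY fine set with `E U ∩ D⁻¹{U} ⊆ T` for `U` in the window `W`.  If for `(ν.map D)`-a.e. `U ∈ W` the `w`-weighted conditional law `κ_U = condLaw ν D U`
gives `q·∫⁻ w dκ_U ≤ ∫⁻_{E U} w dκ_U`, then `q·(ν.withDensity w)(D⁻¹B) ≤ (ν.withDensity w)(D⁻¹B ∩ T)` for every measurable `B ⊆ W` — the right side being an OUTER measure
when `T` is not measurable (measurable hull `toMeasurable`, disintegration ✓`withDensity_preimage_inter_eq_lintegral_condLaw`, fibre support ✓`condLaw_fibre_ae`).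
[cite: Balaban1985Averaging, (10) p.19] -/
theorem mul_le_withDensity_preimage_inter_of_fibrewise (ν : Measure β) [IsFiniteMeasure ν] {D : β → α} (hD : Measurable D)
    {w : β → ℝ≥0∞} (hw : Measurable w) {W : Set α} (E : α → Set β) {T : Set β}
    (hET : ∀ U ∈ W, ∀ V, D V = U → V ∈ E U → V ∈ T) {q : ℝ≥0∞}
    (hfib : ∀ᵐ U ∂(ν.map D), U ∈ W → q * ∫⁻ V, w V ∂(condLaw ν D U) ≤ ∫⁻ V in E U, w V ∂(condLaw ν D U)) :
    ∀ B : Set α, MeasurableSet B → B ⊆ W → q * (ν.withDensity w) (D ⁻¹' B) ≤ (ν.withDensity w) (D ⁻¹' B ∩ T) := by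
  intro B hB hBW
  have hSm : MeasurableSet (toMeasurable (ν.withDensity w) (D ⁻¹' B ∩ T)) := measurableSet_toMeasurable _ _
  have hAS : D ⁻¹' B ∩ T ⊆ toMeasurable (ν.withDensity w) (D ⁻¹' B ∩ T) := subset_toMeasurable _ _
  rw [← measure_toMeasurable (D ⁻¹' B ∩ T)]
  refine le_trans ?_ (measure_mono (Set.inter_subset_right : D ⁻¹' B ∩ toMeasurable (ν.withDensity w) (D ⁻¹' B ∩ T) ⊆ _))
  rw [withDensity_preimage_inter_eq_lintegral_condLaw ν hD hw hB hSm]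
  have huniv : (ν.withDensity w) (D ⁻¹' B) = ∫⁻ U in B, (∫⁻ V, w V ∂(condLaw ν D U)) ∂(ν.map D) := by
    rw [← Set.inter_univ (D ⁻¹' B), withDensity_preimage_inter_eq_lintegral_condLaw ν hD hw hB MeasurableSet.univ]
    simp only [Measure.restrict_univ]
  rw [huniv, ← lintegral_const_mul q hw.lintegral_kernel]
  refine setLIntegral_mono_ae' hB ?_
  filter_upwards [hfib, condLaw_fibre_ae ν hD] with U hU hfibre hUB
  refine (hU (hBW hUB)).trans ?_
  have hF : {V : β | D V = U} =ᵐ[condLaw ν D U] (Set.univ : Set β) := by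
    rw [ae_eq_univ]
    exact (prob_compl_eq_zero_iff (measurableSet_eq_fun hD measurable_const)).mpr hfibre
  calc ∫⁻ V in E U, w V ∂(condLaw ν D U) = ∫⁻ V in E U ∩ {V : β | D V = U}, w V ∂(condLaw ν D U) :=
        (setLIntegral_congr (MeasureTheory.inter_ae_eq_left_of_ae_eq_univ hF)).symm
    _ ≤ ∫⁻ V in toMeasurable (ν.withDensity w) (D ⁻¹' B ∩ T), w V ∂(condLaw ν D U) :=
        lintegral_mono_set fun V hV => hAS ⟨show D V ∈ B by rw [hV.2]; exact hUB, hET U (hBW hUB) V hV.2 hV.1⟩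

end Generic

/-! ## §2 The runs: TUBE∘'s inequality at `(J, K)` for ANY centre map, from the fibrewise tube charge -/

section Runs

variable (F : T3Family) {γ : ℝ} (c b₀ p₀ r : ℝ) {J K : ℕ} (hJK : J + 1 ≤ K)

/-- ★★★ **TUBE∘'s INEQUALITY ⟸ A FIBREWISE TUBE CHARGE** (any centre map `σ`, measurable or not): if for `(dU_K.map D_{J,K})`-almost every INTERIOR datum `U`
(`PlaqSmall θ_J(c·b₀) U`) the Boltzmann-weighted conditional Haar law of the run-`K` field given `D_{J,K} = U` charges the `r`-link-tube around the centre `σ U`,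
read at height `K − J − 1` — `ofReal q·∫⁻ e^{−β_K A} dκ_U ≤ ∫⁻_{ {V | ∀ b, dist1((σ U b)⁻¹·D_{J+1,K}V b) < r} } e^{−β_K A} dκ_U` — then for every measurable interior `B`:
`ofReal q·Gibbs_K(D_{J,K}⁻¹B) ≤ Gibbs_K(D_{J,K}⁻¹B ∩ {V | ∀ b, dist1((σ(D_{J,K}V) b)⁻¹·D_{J+1,K}V b) < r})` — TUBE∘'s sentence at `(J, K)` VERBATIM.  (§1 with
`E U := tube_r(σ U)`, `T :=` TUBE∘'s event: on the fibre `D_{J,K}V = U` the two coincide; ✓`gibbsK_eq_smul_withDensity` cancels `Z_K`.)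
[cite: Balaban1985UV3, (7) p.257 and (38)-(40) p.266; Balaban1985Averaging, (10) p.19] -/
theorem gibbsK_sectionTube_of_fibrewise
    (σ : GaugeField (F.P J) 0 (Matrix.specialUnitaryGroup (Fin 2) ℂ) → GaugeField (F.P (J + 1)) 0 (Matrix.specialUnitaryGroup (Fin 2) ℂ)) {q : ℝ}
    (hfib : ∀ᵐ U ∂((fieldMeasure (F.P K) 0 (Matrix.specialUnitaryGroup (Fin 2) ℂ)).map (descendTo F ℰp J K ((Nat.le_succ J).trans hJK))),
      PlaqSmall (θBal F.L γ (c * b₀) p₀ J) U →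
        ENNReal.ofReal q * ∫⁻ V, ENNReal.ofReal (boltzmann (F.P K) ((F.scheme ℰp γ).β K) V)
            ∂(condLaw (fieldMeasure (F.P K) 0 (Matrix.specialUnitaryGroup (Fin 2) ℂ)) (descendTo F ℰp J K ((Nat.le_succ J).trans hJK)) U) ≤
          ∫⁻ V in {V | ∀ b : PBond (F.P (J + 1)) 0, dist1 ((σ U b)⁻¹ * descendTo F ℰp (J + 1) K hJK V b) < r},
            ENNReal.ofReal (boltzmann (F.P K) ((F.scheme ℰp γ).β K) V)
            ∂(condLaw (fieldMeasure (F.P K) 0 (Matrix.specialUnitaryGroup (Fin 2) ℂ)) (descendTo F ℰp J K ((Nat.le_succ J).trans hJK)) U)) :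
    ∀ (B : Set (GaugeField (F.P J) 0 (Matrix.specialUnitaryGroup (Fin 2) ℂ))), MeasurableSet B →
      B ⊆ {U | PlaqSmall (θBal F.L γ (c * b₀) p₀ J) U} →
      ENNReal.ofReal q * gibbsK F ℰp γ K (descendTo F ℰp J K ((Nat.le_succ J).trans hJK) ⁻¹' B) ≤
        gibbsK F ℰp γ K (descendTo F ℰp J K ((Nat.le_succ J).trans hJK) ⁻¹' B ∩
          {V | ∀ b : PBond (F.P (J + 1)) 0,
            dist1 ((σ (descendTo F ℰp J K ((Nat.le_succ J).trans hJK) V) b)⁻¹ * descendTo F ℰp (J + 1) K hJK V b) < r}) := by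
  intro B hB hBW
  have hD : Measurable (descendTo F ℰp J K ((Nat.le_succ J).trans hJK)) := measurable_descendTo F ℰp measurableE_ℰp _
  have hw : Measurable fun U : GaugeField (F.P K) 0 (Matrix.specialUnitaryGroup (Fin 2) ℂ) =>
      ENNReal.ofReal (boltzmann (F.P K) ((F.scheme ℰp γ).β K) U) := (measurable_boltzmann RegularGaugeGroup.measurable_reTr _ _).ennreal_ofReal
  have hgen := mul_le_withDensity_preimage_inter_of_fibrewise (fieldMeasure (F.P K) 0 (Matrix.specialUnitaryGroup (Fin 2) ℂ)) hD hw
    (W := {U | PlaqSmall (θBal F.L γ (c * b₀) p₀ J) U})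
    (fun U => {V | ∀ b : PBond (F.P (J + 1)) 0, dist1 ((σ U b)⁻¹ * descendTo F ℰp (J + 1) K hJK V b) < r})
    (T := {V | ∀ b : PBond (F.P (J + 1)) 0,
      dist1 ((σ (descendTo F ℰp J K ((Nat.le_succ J).trans hJK) V) b)⁻¹ * descendTo F ℰp (J + 1) K hJK V b) < r})
    (fun U _ V hVU hVE => by
      show ∀ b : PBond (F.P (J + 1)) 0,
        dist1 ((σ (descendTo F ℰp J K ((Nat.le_succ J).trans hJK) V) b)⁻¹ * descendTo F ℰp (J + 1) K hJK V b) < r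
      rw [hVU]
      exact hVE)
    hfib B hB hBW
  rw [gibbsK_eq_smul_withDensity]
  simp only [Measure.smul_apply, smul_eq_mul]
  rw [mul_left_comm]
  exact mul_le_mul_right hgen _

end Runs

/-! ## §3 The knits: ⟨FIB-TUBE∘⟩ ⇒ TUBE∘ verbatim, and ⇒ TUBE∘ without the token `Measurable σ` -/

section Knit

/-- ★★★ **⟨FIB-TUBE∘⟩ ⇒ TUBE∘ `SectionTubeMassIntCan` VERBATIM** (LINE g22-4 `persistence_geometry.lean` 970dcf79 ll.137–158).  Hypothesis ⟨FIB-TUBE∘⟩: TUBE∘'s quantifier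
prefix and admissibility clause (for EVERY centre map `σ` — no measurability asked), then `∃ q > 0` such that for every run `K ≥ J+1`, for `(dU_K.map D_{J,K})`-a.e.
INTERIOR datum `U`, the Boltzmann-weighted conditional Haar law given `D_{J,K} = U` puts fraction `≥ q` of its mass on the `r`-link-tube around `σ U` read at height
`K − J − 1`.  Conclusion: TUBE∘'s text byte for byte (its `Measurable σ` hypothesis is accepted and not used).  [cite: Balaban1985UV3, (7) p.257 and (38)-(40) p.266;
Balaban1987RG1, (0.18)-(0.22) p.255; Balaban1985Averaging, Prop. 1 p.22] -/
theorem sectionTubeMassIntCan_of_fibrewise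
    (h : ∀ (L : ℕ), ∃ c₀ : ℝ, 0 < c₀ ∧ c₀ ≤ 1 ∧ ∀ (c : ℝ), 0 < c → c ≤ c₀ → ∃ pS : ℝ, ∀ (b₀ p₀ : ℝ), 0 < b₀ → pS ≤ p₀ → 0 < p₀ →
      ∃ γ₁ : ℝ, 0 < γ₁ ∧ ∀ (F : T3Family) (γ : ℝ), F.L = L → 0 < γ → γ ≤ γ₁ →
        ∀ (J : ℕ) (r : ℝ), 0 < r →
          ∀ σ : GaugeField (F.P J) 0 (Matrix.specialUnitaryGroup (Fin 2) ℂ) → GaugeField (F.P (J + 1)) 0 (Matrix.specialUnitaryGroup (Fin 2) ℂ),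
            (∀ U : GaugeField (F.P J) 0 (Matrix.specialUnitaryGroup (Fin 2) ℂ), PlaqSmall (θBal F.L γ (c * b₀) p₀ J) U →
              descendTo F ℰp J (J + 1) (Nat.le_succ J) (σ U) = U ∧ PlaqSmall (θBal F.L γ b₀ p₀ (J + 1)) (σ U)) →
            ∃ q : ℝ, 0 < q ∧ ∀ (K : ℕ) (hJK : J + 1 ≤ K),
              ∀ᵐ U ∂((fieldMeasure (F.P K) 0 (Matrix.specialUnitaryGroup (Fin 2) ℂ)).map (descendTo F ℰp J K ((Nat.le_succ J).trans hJK))),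
                PlaqSmall (θBal F.L γ (c * b₀) p₀ J) U →
                  ENNReal.ofReal q * ∫⁻ V, ENNReal.ofReal (boltzmann (F.P K) ((F.scheme ℰp γ).β K) V)
                      ∂(condLaw (fieldMeasure (F.P K) 0 (Matrix.specialUnitaryGroup (Fin 2) ℂ)) (descendTo F ℰp J K ((Nat.le_succ J).trans hJK)) U) ≤
                    ∫⁻ V in {V | ∀ b : PBond (F.P (J + 1)) 0, dist1 ((σ U b)⁻¹ * descendTo F ℰp (J + 1) K hJK V b) < r},
                      ENNReal.ofReal (boltzmann (F.P K) ((F.scheme ℰp γ).β K) V)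
                      ∂(condLaw (fieldMeasure (F.P K) 0 (Matrix.specialUnitaryGroup (Fin 2) ℂ)) (descendTo F ℰp J K ((Nat.le_succ J).trans hJK)) U)) :
    ∀ (L : ℕ), ∃ c₀ : ℝ, 0 < c₀ ∧ c₀ ≤ 1 ∧ ∀ (c : ℝ), 0 < c → c ≤ c₀ → ∃ pS : ℝ, ∀ (b₀ p₀ : ℝ), 0 < b₀ → pS ≤ p₀ → 0 < p₀ →
      ∃ γ₁ : ℝ, 0 < γ₁ ∧ ∀ (F : T3Family) (γ : ℝ), F.L = L → 0 < γ → γ ≤ γ₁ →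
        ∀ (J : ℕ) (r : ℝ), 0 < r →
          ∀ σ : GaugeField (F.P J) 0 (Matrix.specialUnitaryGroup (Fin 2) ℂ) → GaugeField (F.P (J + 1)) 0 (Matrix.specialUnitaryGroup (Fin 2) ℂ), Measurable σ →
            (∀ U : GaugeField (F.P J) 0 (Matrix.specialUnitaryGroup (Fin 2) ℂ), PlaqSmall (θBal F.L γ (c * b₀) p₀ J) U →
              descendTo F ℰp J (J + 1) (Nat.le_succ J) (σ U) = U ∧ PlaqSmall (θBal F.L γ b₀ p₀ (J + 1)) (σ U)) →
            ∃ q : ℝ, 0 < q ∧ ∀ (K : ℕ) (hJK : J + 1 ≤ K)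
              (B : Set (GaugeField (F.P J) 0 (Matrix.specialUnitaryGroup (Fin 2) ℂ))), MeasurableSet B →
                B ⊆ {U | PlaqSmall (θBal F.L γ (c * b₀) p₀ J) U} →
                ENNReal.ofReal q * gibbsK F ℰp γ K (descendTo F ℰp J K ((Nat.le_succ J).trans hJK) ⁻¹' B) ≤
                  gibbsK F ℰp γ K (descendTo F ℰp J K ((Nat.le_succ J).trans hJK) ⁻¹' B ∩
                    {V | ∀ b : PBond (F.P (J + 1)) 0,
                      dist1 ((σ (descendTo F ℰp J K ((Nat.le_succ J).trans hJK) V) b)⁻¹ *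
                        descendTo F ℰp (J + 1) K hJK V b) < r}) := by
  intro L
  obtain ⟨c₀, hc₀, hc₀1, hc⟩ := h L
  refine ⟨c₀, hc₀, hc₀1, fun c hcpos hcle => ?_⟩
  obtain ⟨pS, hpS⟩ := hc c hcpos hcle
  refine ⟨pS, fun b₀ p₀ hb₀ hpS' hp₀ => ?_⟩
  obtain ⟨γ₁, hγ₁, hγ₁F⟩ := hpS b₀ p₀ hb₀ hpS' hp₀
  refine ⟨γ₁, hγ₁, fun F γ hFL hγ hγle J r hr σ _ hadm => ?_⟩
  obtain ⟨q, hq, hK⟩ := hγ₁F F γ hFL hγ hγle J r hr σ hadm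
  exact ⟨q, hq, fun K hJK B hB hBW => gibbsK_sectionTube_of_fibrewise F c b₀ p₀ r hJK σ (hK K hJK) B hB hBW⟩

/-- ★★★ **⟨FIB-TUBE∘⟩ ⇒ TUBE∘ WITHOUT THE TOKEN `Measurable σ →`** (the measurability-free re-typing recommended by LEAD w3-20520 g18 together with
✓`…InteriorSectionPointwise.interiorSection_choice` as GEOM∘): same hypothesis, conclusion = TUBE∘'s text with `Measurable σ →` deleted — for EVERY centre map the
tube event is charged, as an OUTER measure when it is not measurable.  [cite: Balaban1985UV3, (7) p.257 and (38)-(40) p.266; Balaban1985Averaging, Prop. 1 p.22] -/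
theorem sectionTubeMass_noMeas_of_fibrewise
    (h : ∀ (L : ℕ), ∃ c₀ : ℝ, 0 < c₀ ∧ c₀ ≤ 1 ∧ ∀ (c : ℝ), 0 < c → c ≤ c₀ → ∃ pS : ℝ, ∀ (b₀ p₀ : ℝ), 0 < b₀ → pS ≤ p₀ → 0 < p₀ →
      ∃ γ₁ : ℝ, 0 < γ₁ ∧ ∀ (F : T3Family) (γ : ℝ), F.L = L → 0 < γ → γ ≤ γ₁ →
        ∀ (J : ℕ) (r : ℝ), 0 < r →
          ∀ σ : GaugeField (F.P J) 0 (Matrix.specialUnitaryGroup (Fin 2) ℂ) → GaugeField (F.P (J + 1)) 0 (Matrix.specialUnitaryGroup (Fin 2) ℂ),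
            (∀ U : GaugeField (F.P J) 0 (Matrix.specialUnitaryGroup (Fin 2) ℂ), PlaqSmall (θBal F.L γ (c * b₀) p₀ J) U →
              descendTo F ℰp J (J + 1) (Nat.le_succ J) (σ U) = U ∧ PlaqSmall (θBal F.L γ b₀ p₀ (J + 1)) (σ U)) →
            ∃ q : ℝ, 0 < q ∧ ∀ (K : ℕ) (hJK : J + 1 ≤ K),
              ∀ᵐ U ∂((fieldMeasure (F.P K) 0 (Matrix.specialUnitaryGroup (Fin 2) ℂ)).map (descendTo F ℰp J K ((Nat.le_succ J).trans hJK))),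
                PlaqSmall (θBal F.L γ (c * b₀) p₀ J) U →
                  ENNReal.ofReal q * ∫⁻ V, ENNReal.ofReal (boltzmann (F.P K) ((F.scheme ℰp γ).β K) V)
                      ∂(condLaw (fieldMeasure (F.P K) 0 (Matrix.specialUnitaryGroup (Fin 2) ℂ)) (descendTo F ℰp J K ((Nat.le_succ J).trans hJK)) U) ≤
                    ∫⁻ V in {V | ∀ b : PBond (F.P (J + 1)) 0, dist1 ((σ U b)⁻¹ * descendTo F ℰp (J + 1) K hJK V b) < r},
                      ENNReal.ofReal (boltzmann (F.P K) ((F.scheme ℰp γ).β K) V)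
                      ∂(condLaw (fieldMeasure (F.P K) 0 (Matrix.specialUnitaryGroup (Fin 2) ℂ)) (descendTo F ℰp J K ((Nat.le_succ J).trans hJK)) U)) :
    ∀ (L : ℕ), ∃ c₀ : ℝ, 0 < c₀ ∧ c₀ ≤ 1 ∧ ∀ (c : ℝ), 0 < c → c ≤ c₀ → ∃ pS : ℝ, ∀ (b₀ p₀ : ℝ), 0 < b₀ → pS ≤ p₀ → 0 < p₀ →
      ∃ γ₁ : ℝ, 0 < γ₁ ∧ ∀ (F : T3Family) (γ : ℝ), F.L = L → 0 < γ → γ ≤ γ₁ →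
        ∀ (J : ℕ) (r : ℝ), 0 < r →
          ∀ σ : GaugeField (F.P J) 0 (Matrix.specialUnitaryGroup (Fin 2) ℂ) → GaugeField (F.P (J + 1)) 0 (Matrix.specialUnitaryGroup (Fin 2) ℂ),
            (∀ U : GaugeField (F.P J) 0 (Matrix.specialUnitaryGroup (Fin 2) ℂ), PlaqSmall (θBal F.L γ (c * b₀) p₀ J) U →
              descendTo F ℰp J (J + 1) (Nat.le_succ J) (σ U) = U ∧ PlaqSmall (θBal F.L γ b₀ p₀ (J + 1)) (σ U)) →
            ∃ q : ℝ, 0 < q ∧ ∀ (K : ℕ) (hJK : J + 1 ≤ K)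
              (B : Set (GaugeField (F.P J) 0 (Matrix.specialUnitaryGroup (Fin 2) ℂ))), MeasurableSet B →
                B ⊆ {U | PlaqSmall (θBal F.L γ (c * b₀) p₀ J) U} →
                ENNReal.ofReal q * gibbsK F ℰp γ K (descendTo F ℰp J K ((Nat.le_succ J).trans hJK) ⁻¹' B) ≤
                  gibbsK F ℰp γ K (descendTo F ℰp J K ((Nat.le_succ J).trans hJK) ⁻¹' B ∩
                    {V | ∀ b : PBond (F.P (J + 1)) 0,
                      dist1 ((σ (descendTo F ℰp J K ((Nat.le_succ J).trans hJK) V) b)⁻¹ *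
                        descendTo F ℰp (J + 1) K hJK V b) < r}) := by
  intro L
  obtain ⟨c₀, hc₀, hc₀1, hc⟩ := h L
  refine ⟨c₀, hc₀, hc₀1, fun c hcpos hcle => ?_⟩
  obtain ⟨pS, hpS⟩ := hc c hcpos hcle
  refine ⟨pS, fun b₀ p₀ hb₀ hpS' hp₀ => ?_⟩
  obtain ⟨γ₁, hγ₁, hγ₁F⟩ := hpS b₀ p₀ hb₀ hpS' hp₀
  refine ⟨γ₁, hγ₁, fun F γ hFL hγ hγle J r hr σ hadm => ?_⟩
  obtain ⟨q, hq, hK⟩ := hγ₁F F γ hFL hγ hγle J r hr σ hadm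
  exact ⟨q, hq, fun K hJK B hB hBW => gibbsK_sectionTube_of_fibrewise F c b₀ p₀ r hJK σ (hK K hJK) B hB hBW⟩

end Knit

end Summit.QuantumFields.YangMills.Theorems.FluctuationComparisonRegPrIntLSectionTubeFibrewise

end
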